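import Literature.AlgebraicGeometry.Frobenioids.ArithmeticDivisorsFunctor
import Literature.IUT.LogVolume.ArithmeticDivisorsFrdBridge
import Literature.IUT.LogVolume.RArithmeticDivisorsPullback
import HarnessLib

/-!
# Frobenioids I, Ex. 6.3 / Thm. 6.4 (i)(ii): `deg^arith_L(σ^* d) = [L : M] · deg^arith_M(d)` — the arithmetic
# degree under pull-back of arithmetic divisors

Mochizuki, *The geometry of Frobenioids I*, Kyushu J. Math. **62** (2008), Ex. 6.3 p. 113 (the monoid `Φ` on
`D`: `Spec L ↦ Φ(L)`, arrows ↦ pull-backs; the arithmetic degree `deg^arith_L : Φ(L)^gp → ℝ`) and Thm. 6.4 (i)/(ii)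
pp. 114–115 (`δ_A : Pic_Φ(A) ⥲ ℝ` "natural", and ONE degree `deg(Ψ^rlf)` for all Frobenius-trivial objects over the
connected base) [cite: MochizukiFrdI2008, Ex. 6.3 p.113] [cite: MochizukiFrdI2008, Thm. 6.4 (i) p.115]; the scaling
`deg(𝔞|_K) = [K:F] · deg(𝔞)` is [IUTchIV] Def. 1.9 (i) p. 22 in abc-iut-S's normalisation (tree:
`Literature.IUT.LogVolume.degF_pullback`) [cite: Mochizuki2012, IUTchIV Def. 1.9 (i) p. 22].

PROOF-ONLY (cell abc-iut; L1-lead R112 (1) row **E4 «δ at THE instance», scaling half**: "`δ ∘ picPull σ = [L:M] • δ`,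
i.e. `arithDegree L (ArithDivisor.pullback σ D) = [L:M] * arithDegree M D`"; seat abc-iut-L1-d2).  Nothing is
re-derived: the fundamental identity `Σ_{w|v} e_w f_w = [L:M]` and `Σ_{w|v} [L_w:M_v] = [L:M]` live in abc-iut-S's
`RArithmeticDivisorsPullback.lean`; this file BRIDGES abc-iut-L1-t3's pull-back `ArithDivisor.pullback σ`
(`ArithmeticDivisorsFunctor.lean`: `ramIdxPlace`/`underPlace`/`InfinitePlace.comap`) to abc-iut-S's `ADivisor.pullback`
(`pullbackWeight`/`Place.below`) along the comparison `ADivisor.ofArithDivisor` (`ArithmeticDivisorsFrdBridge.lean`):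
* `ArithPullback.under_algebraMap`, `ramIdx_algebraMap` — the primes below / ramification indices agree;
* `ADivisor.ofArithDivisor_pullback` — `ofArithDivisor (σ^* d) = (ofArithDivisor d)|_L` for `σ = algebraMap M L`;
* **`arithDegree_pullback`** — `deg^arith_L(σ^* d) = [L:M] · deg^arith_M(d)` (and `arithDegree_pullback_ringHom` for an
  arbitrary embedding `σ : M →+* L`, `[L:M]` taken for the module structure `σ`), with the effective form
  `arithDegree_toArithDivisor_pullback`.
-/

noncomputable section

namespace Literature.AlgebraicGeometry.Frobenioids

open NumberField IsDedekindDomain Literature.IUT.LogVolume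

universe u₁ u₂

variable {M : Type u₁} [Field M] [NumberField M] {L : Type u₂} [Field L] [NumberField L]

namespace ArithPullback

omit [NumberField M] [NumberField L] in
/-- The prime below `w` along `algebraMap M L` (abc-iut-L1-t3's `under`) is abc-iut-S's `finBelow`.
[cite: MochizukiFrdI2008, Ex. 6.3 p.113] -/
theorem under_algebraMap [Algebra M L] (w : HeightOneSpectrum (𝓞 L)) :
    under (algebraMap M L) w = finBelow M L w :=
  HeightOneSpectrum.ext rfl

omit [NumberField M] [NumberField L] in
/-- The ramification index along `algebraMap M L` (abc-iut-L1-t3's `ramIdx`) is abc-iut-S's weight `m_w = e_{w|v}`.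
[cite: MochizukiFrdI2008, Ex. 6.3 p.113] -/
theorem ramIdx_algebraMap [Algebra M L] (w : HeightOneSpectrum (𝓞 L)) :
    ramIdx (algebraMap M L) w = pullbackWeight M L (Sum.inr w) := by
  rw [pullbackWeight, ← under_algebraMap]
  rfl

end ArithPullback

open ArithPullback

/-- **The two pull-backs agree**: along `ADivisor.ofArithDivisor`, abc-iut-L1-t3's `σ^*` (`ArithDivisor.pullback`,
`(σ^* d)_w = e(w|v) d_v` at finite `w`, `= d_{w|_M}` at archimedean `w`) is abc-iut-S's `𝔞|_L` (`m_w · c_{v(w)}`,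
`m_w = e_{w|v}` resp. `[L_w : M_v]`), for `σ = algebraMap M L`. [cite: MochizukiFrdI2008, Ex. 6.3 p.113] -/
theorem ADivisor.ofArithDivisor_pullback [Algebra M L] (d : ArithDivisor M) :
    ADivisor.ofArithDivisor L (ArithDivisor.pullback (algebraMap M L) d) =
      (ADivisor.ofArithDivisor M d).pullback M L := by
  ext (w | w)
  · -- archimedean `w`: `mult_L(w) · t_{w|_M} = [L_w : M_v] · (mult_M(v) · t_v)`
    rw [ADivisor.ofArithDivisor_apply_inl, ArithDivisor.pullback_snd, ADivisor.pullback_apply]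
    show (w.mult : ℝ) * d.2 (w.comap (algebraMap M L)) =
      (pullbackWeight M L (Sum.inl w) : ℝ) * ADivisor.ofArithDivisor M d (Sum.inl (w.comap (algebraMap M L)))
    rw [ADivisor.ofArithDivisor_apply_inl, ← mul_assoc, ← Nat.cast_mul, pullbackWeight_mul_mult_comap]
  · -- finite `w`: `e(w|v) d_v` on both sides
    rw [ADivisor.ofArithDivisor_apply_inr, ArithDivisor.pullback_fst, ADivisor.pullback_apply]
    show (((ramIdxPlace (algebraMap M L) (FinitePlace.mk w) : ℤ) * d.1 (underPlace (algebraMap M L)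
        (FinitePlace.mk w)) : ℤ) : ℝ) =
      (pullbackWeight M L (Sum.inr w) : ℝ) * ADivisor.ofArithDivisor M d (Sum.inr (finBelow M L w))
    rw [ADivisor.ofArithDivisor_apply_inr, ramIdxPlace, underPlace, FinitePlace.maximalIdeal_mk, ramIdx_algebraMap,
      under_algebraMap, Int.cast_mul, Int.cast_natCast]

/-- **`deg^arith_L(σ^* d) = [L : M] · deg^arith_M(d)`** for `σ = algebraMap M L` (pull-back multiplies arithmetic
degrees by the degree of the extension: `Σ_{w|v} e_{w|v} f_{w|v} = [L:M]` at finite `v`, `Σ_{w|v} [L_w:M_v] = [L:M]` at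
archimedean `v` — abc-iut-S's `degF_pullback` through the bridge). [cite: MochizukiFrdI2008, Thm. 6.4 (i) p.115] -/
theorem arithDegree_pullback [Algebra M L] (d : ArithDivisor M) :
    arithDegree L (ArithDivisor.pullback (algebraMap M L) d) = Module.finrank M L * arithDegree M d := by
  rw [← degF_ofArithDivisor, ADivisor.ofArithDivisor_pullback, degF_pullback, degF_ofArithDivisor]

/-- The same for an arbitrary embedding `σ : M →+* L` of number fields, `[L : M]` being the degree for the module
structure defined by `σ`. [cite: MochizukiFrdI2008, Thm. 6.4 (i) p.115] -/
theorem arithDegree_pullback_ringHom (σ : M →+* L) (d : ArithDivisor M) :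
    arithDegree L (ArithDivisor.pullback σ d) = (letI := σ.toAlgebra; Module.finrank M L) * arithDegree M d := by
  letI : Algebra M L := σ.toAlgebra
  exact arithDegree_pullback (M := M) (L := L) d

/-- **Effective form**: `deg^arith_L(σ^* D) = [L : M] · deg^arith_M(D)` for `D ∈ Φ(M)`, `σ^* : Φ(M) → Φ(L)` the
pull-back of EFFECTIVE arithmetic divisors (the transition map of the monoid `Φ` on `D`, Ex. 6.3).
[cite: MochizukiFrdI2008, Ex. 6.3 p.113] -/
theorem arithDegree_toArithDivisor_pullback_ringHom (σ : M →+* L) (D : EffArithDivisor M) :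
    arithDegree L (EffArithDivisor.toArithDivisor L (EffArithDivisor.pullback σ D)) =
      (letI := σ.toAlgebra; Module.finrank M L) * arithDegree M (EffArithDivisor.toArithDivisor M D) := by
  rw [EffArithDivisor.toArithDivisor_pullback, arithDegree_pullback_ringHom]

/-- Effective form for `σ = algebraMap M L`. [cite: MochizukiFrdI2008, Ex. 6.3 p.113] -/
theorem arithDegree_toArithDivisor_pullback [Algebra M L] (D : EffArithDivisor M) :
    arithDegree L (EffArithDivisor.toArithDivisor L (EffArithDivisor.pullback (algebraMap M L) D)) =
      Module.finrank M L * arithDegree M (EffArithDivisor.toArithDivisor M D) := by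
  rw [EffArithDivisor.toArithDivisor_pullback, arithDegree_pullback]

end Literature.AlgebraicGeometry.Frobenioids

end
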